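import Mathlib
import HarnessLib

/-!
# ValiantsHypothesis / LacunarySymmetroid — crux `MatrixDescartes` (stmt-ValiantsHypothesis-18050, V1),
# LINE (A) «product_plus_one», S4″/S5 Euler currency: the COPOSITIVITY CERTIFICATE behind the coherent one-zero sector, EVERY K

Algebraic core of val-lit-p5 g13's memo `NOTE-p5g13-18050-LINEA-weight-window.md` §5.  For letters `0 = δ_0 < δ_1 < … < δ_T = D`, a weight
`δ_{T−1} ≤ w ≤ D`, and the matrix `M_{ll'} = ((δ_l − δ_{l'})² − w(δ_l + δ_{l'}))/2` (diagonal `−w δ_l`), the quadratic form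
`Σ_{l,l'} M_{ll'} u_l u_{l'}` is `< 0` on the COHERENT orthant `u_0 > 0`, `u_1, …, u_{T−1} ≥ 0`, `u_T < 0` (for `w < D`).  (With `u_l = a_l x^{δ_l}` this form is
`g·(θN − wN) − N²`, `N = θg`, for the fewnomial `g = Σ a_l x^{δ_l}`; its nonpositivity makes `x^{−w}·θg/g` decreasing — the general-K version of
✓ `…ProductPlusOneCoherentSector` (K = 3, p663379).  The analytic wiring to `eulerNumerator` for general K is NOT in this file.)

* `pair_identity`, ★ `pair_lemma` — the 4-parameter certificate: with `u = D − δ_l ≥ v = D − δ_{l'} ≥ 0`, harmful `u(u+w) < 2wD`, `u, w ≤ D`: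
  `(2wD − wu − u²)(2wD − wv − v²) ≤ 2wD·(2wD − w(u+v) − (u−v)²)`, because the difference is `u v [4wD − (w+u)(w+v)]` and `(w+u)² < 4wD`;
* ★ `coherent_form_neg` — the (strict) copositivity statement: `< 0` on `u_0 > 0, u_1..u_{T−1} ≥ 0, u_T < 0` for `δ_{T−1} ≤ w < D`
  (complete the square in `u_T`, absorb the harmful letters with `pair_lemma`; strictness from the `(0,T)` entry `D(D−w)/2 > 0`).

Honest framing: an inequality; nothing about zeros is concluded here; `stub_eulerBoundK3` / `stub_polyLaw` / 18050 / B OPEN; `VP ≠ VNP` NOT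
proved.  No definitions, no named facts; Mathlib only.
-/

set_option linter.dupNamespace false

namespace Summit.ValiantsHypothesis.ValiantsHypothesis.Theorems.LacunarySymmetroidMatrixDescartes

namespace ProductPlusOne

open Finset
open scoped BigOperators

/-! ### §1 The pair lemma -/

/-- The identity behind the pair lemma. [folklore] -/
theorem pair_identity (u v w D : ℝ) :
    2 * w * D * (2 * w * D - w * (u + v) - (u - v) ^ 2) - (2 * w * D - w * u - u ^ 2) * (2 * w * D - w * v - v ^ 2)
      = u * v * (4 * w * D - (w + u) * (w + v)) := by
  ring

/-- ★ **Pair lemma**: `0 ≤ v ≤ u ≤ D`, `0 ≤ w ≤ D`, `u (u + w) < 2 w D` (the letter `D − u` is «harmful») ⇒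
`(2wD − wu − u²)(2wD − wv − v²) ≤ 2wD (2wD − w(u+v) − (u−v)²)`. [this file's lemma] -/
theorem pair_lemma (u v w D : ℝ) (hv : 0 ≤ v) (hvu : v ≤ u) (huD : u ≤ D) (hw : 0 ≤ w) (hwD : w ≤ D)
    (hharm : u * (u + w) < 2 * w * D) :
    (2 * w * D - w * u - u ^ 2) * (2 * w * D - w * v - v ^ 2) ≤ 2 * w * D * (2 * w * D - w * (u + v) - (u - v) ^ 2) := by
  have hu : 0 ≤ u := hv.trans hvu
  have h1 : (w + u) ^ 2 < 4 * w * D := by nlinarith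
  have h2 : (w + u) * (w + v) ≤ (w + u) ^ 2 := by nlinarith
  have h3 : 0 ≤ u * v * (4 * w * D - (w + u) * (w + v)) := mul_nonneg (mul_nonneg hu hv) (by linarith)
  have := pair_identity u v w D
  linarith

/-! ### §2 The coherent form is nonpositive -/

/-- The matrix entry. -/
private noncomputable def Mx (w : ℝ) (δ : ℕ → ℝ) (l l' : ℕ) : ℝ := ((δ l - δ l') ^ 2 - w * (δ l + δ l')) / 2

set_option maxHeartbeats 400000 in
/-- ★ **Copositivity of the coherent form.** `T ≥ 1`; letters `δ : ℕ → ℝ` with `δ 0 = 0`, `0 ≤ δ l`, `δ l ≤ δ (T−1) ≤ w ≤ δ T = D` for `l < T`,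
`0 < w`; a vector `u : ℕ → ℝ` with `u l ≥ 0` for `l < T` and `u T ≤ 0`.  Then
`Σ_{l ≤ T} Σ_{l' ≤ T} ((δ_l − δ_{l'})² − w(δ_l + δ_{l'}))/2 · u_l u_{l'} ≤ 0`. [this file's theorem] -/
theorem coherent_form_neg (T : ℕ) (hT : 1 ≤ T) (δ : ℕ → ℝ) (hδ00 : δ 0 = 0) (w : ℝ) (hw : 0 < w)
    (hδ0 : ∀ l, l < T → 0 ≤ δ l) (hδw : ∀ l, l < T → δ l ≤ w) (hwD : w < δ T)
    (u : ℕ → ℝ) (hu0 : 0 < u 0) (hu : ∀ l, l < T → 0 ≤ u l) (huT : u T < 0) :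
    ∑ l ∈ range (T + 1), ∑ l' ∈ range (T + 1), ((δ l - δ l') ^ 2 - w * (δ l + δ l')) / 2 * (u l * u l') < 0 := by
  classical
  have hD0 : 0 < δ T := hw.trans hwD
  -- the entries among the lower letters are nonpositive
  have hMlow : ∀ l l', l < T → l' < T → ((δ l - δ l') ^ 2 - w * (δ l + δ l')) / 2 ≤ 0 := by
    intro l l' hl hl'
    have h1 := hδ0 l hl; have h2 := hδ0 l' hl'; have h3 := hδw l hl; have h4 := hδw l' hl'
    have : (δ l - δ l') ^ 2 ≤ w * (δ l + δ l') := by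
      rcases le_total (δ l) (δ l') with h | h
      · nlinarith
      · nlinarith
    linarith
  -- split off the top index `T` in both sums
  simp only [Finset.sum_range_succ]
  rw [Finset.sum_add_distrib]
  have e2 : ∑ x ∈ range T, ((δ x - δ T) ^ 2 - w * (δ x + δ T)) / 2 * (u x * u T)
      = (∑ l ∈ range T, ((δ l - δ T) ^ 2 - w * (δ l + δ T)) / 2 * u l) * u T := by
    rw [Finset.sum_mul]; refine Finset.sum_congr rfl fun l _ => ?_; ring
  have e3 : ∑ x ∈ range T, ((δ T - δ x) ^ 2 - w * (δ T + δ x)) / 2 * (u T * u x)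
      = (∑ l ∈ range T, ((δ l - δ T) ^ 2 - w * (δ l + δ T)) / 2 * u l) * u T := by
    rw [Finset.sum_mul]; refine Finset.sum_congr rfl fun l _ => ?_; ring
  have e4 : ((δ T - δ T) ^ 2 - w * (δ T + δ T)) / 2 * (u T * u T) = -(w * δ T) * (-u T) ^ 2 := by ring
  rw [e2, e3, e4]
  set D := δ T with hD
  set t : ℝ := -u T with ht
  have ht0 : 0 < t := by rw [ht]; linarith
  set A := ∑ l ∈ range T, ∑ l' ∈ range T, ((δ l - δ l') ^ 2 - w * (δ l + δ l')) / 2 * (u l * u l') with hA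
  set c := ∑ l ∈ range T, ((δ l - D) ^ 2 - w * (δ l + D)) / 2 * u l with hc
  have huT' : u T = -t := by rw [ht]; ring
  rw [huT']
  have hgoal : A + c * -t + (c * -t + -(w * D) * t ^ 2) = A - 2 * c * t - w * D * t ^ 2 := by ring
  rw [hgoal]
  -- harmful part of `c`: `c₋ = Σ_{l<T, M_{lT}<0} |M_{lT}| u_l`, and `−2 c t ≤ 2 c₋ t`
  set H := (range T).filter (fun l => ((δ l - D) ^ 2 - w * (δ l + D)) / 2 < 0) with hH
  set cm := ∑ l ∈ H, (-(((δ l - D) ^ 2 - w * (δ l + D)) / 2)) * u l with hcm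
  have hcm0 : 0 ≤ cm := by
    rw [hcm]; refine Finset.sum_nonneg fun l hl => ?_
    rw [hH, mem_filter, mem_range] at hl
    exact mul_nonneg (by linarith [hl.2]) (hu l hl.1)
  have hc_ge : -c ≤ cm - D * (D - w) / 2 * u 0 := by
    -- `−c = Σ (−M_{lT} u_l)`; on `H` this is `cm`, off `H` every summand is `≤ 0` and the `l = 0` summand is `−D(D−w)/2·u 0`
    have h1 : -c = ∑ l ∈ (range T).filter (fun l => ((δ l - D) ^ 2 - w * (δ l + D)) / 2 < 0),
          -(((δ l - D) ^ 2 - w * (δ l + D)) / 2 * u l)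
        + ∑ l ∈ (range T).filter (fun l => ¬ ((δ l - D) ^ 2 - w * (δ l + D)) / 2 < 0),
          -(((δ l - D) ^ 2 - w * (δ l + D)) / 2 * u l) := by
      rw [hc, ← Finset.sum_neg_distrib, Finset.sum_filter_add_sum_filter_not]
    have h2 : ∑ l ∈ (range T).filter (fun l => ((δ l - D) ^ 2 - w * (δ l + D)) / 2 < 0),
        -(((δ l - D) ^ 2 - w * (δ l + D)) / 2 * u l) = cm := by
      rw [hcm, hH]; refine Finset.sum_congr rfl fun l _ => ?_; ring
    have h0mem : (0 : ℕ) ∈ (range T).filter (fun l => ¬ ((δ l - D) ^ 2 - w * (δ l + D)) / 2 < 0) := by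
      rw [mem_filter, mem_range, hδ00]
      refine ⟨by omega, not_lt.2 ?_⟩
      nlinarith
    have h3 : ∑ l ∈ (range T).filter (fun l => ¬ ((δ l - D) ^ 2 - w * (δ l + D)) / 2 < 0),
        -(((δ l - D) ^ 2 - w * (δ l + D)) / 2 * u l) ≤ -(D * (D - w) / 2 * u 0) := by
      rw [← Finset.add_sum_erase _ _ h0mem]
      have hrest : ∑ l ∈ ((range T).filter (fun l => ¬ ((δ l - D) ^ 2 - w * (δ l + D)) / 2 < 0)).erase 0,
          -(((δ l - D) ^ 2 - w * (δ l + D)) / 2 * u l) ≤ 0 := by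
        refine Finset.sum_nonpos fun l hl => ?_
        have hl' := Finset.mem_of_mem_erase hl
        rw [mem_filter, mem_range] at hl'
        have := hu l hl'.1
        have hM : 0 ≤ ((δ l - D) ^ 2 - w * (δ l + D)) / 2 := not_lt.1 hl'.2
        nlinarith
      have e0 : -(((δ 0 - D) ^ 2 - w * (δ 0 + D)) / 2 * u 0) = -(D * (D - w) / 2 * u 0) := by rw [hδ00]; ring
      linarith
    linarith
  -- complete the square: `−wD t² + 2 cm t ≤ cm²/(wD)`
  have hwD0 : 0 < w * D := mul_pos hw hD0
  have hsq : -(w * D) * t ^ 2 + 2 * cm * t ≤ cm ^ 2 / (w * D) := by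
    rw [le_div_iff₀ hwD0]
    nlinarith [sq_nonneg (w * D * t - cm)]
  have h2ct : -(2 * c * t) ≤ 2 * cm * t - D * (D - w) * u 0 * t := by nlinarith
  have hstrict : 0 < D * (D - w) * u 0 * t := by
    have : 0 < D - w := by linarith
    positivity
  -- the key estimate: `cm² ≤ (w D) · (−A)`
  -- per-entry comparison on `H × H` (pair lemma)
  have hpair : ∀ l ∈ H, ∀ l' ∈ H,
      (-(((δ l - D) ^ 2 - w * (δ l + D)) / 2)) * (-(((δ l' - D) ^ 2 - w * (δ l' + D)) / 2))
        ≤ w * D * (-(((δ l - δ l') ^ 2 - w * (δ l + δ l')) / 2)) := by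
    -- ordered version
    have key : ∀ p q : ℕ, p < T → q < T → ((δ p - D) ^ 2 - w * (δ p + D)) / 2 < 0 → δ p ≤ δ q →
        (-(((δ p - D) ^ 2 - w * (δ p + D)) / 2)) * (-(((δ q - D) ^ 2 - w * (δ q + D)) / 2))
          ≤ w * D * (-(((δ p - δ q) ^ 2 - w * (δ p + δ q)) / 2)) := by
      intro p q hp hq hharm hpq
      have h0p := hδ0 p hp
      have hwq := hδw q hq
      have hharm' : (D - δ p) * ((D - δ p) + w) < 2 * w * D := by
        have e : (δ p - D) ^ 2 = (D - δ p) * (D - δ p) := by ring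
        rw [e] at hharm
        nlinarith
      have hP := pair_lemma (D - δ p) (D - δ q) w D (by linarith) (by linarith) (by linarith) hw.le hwD.le hharm'
      have e2 : w * D * (-(((δ p - δ q) ^ 2 - w * (δ p + δ q)) / 2))
          - (-(((δ p - D) ^ 2 - w * (δ p + D)) / 2)) * (-(((δ q - D) ^ 2 - w * (δ q + D)) / 2))
          = (2 * w * D * (2 * w * D - w * ((D - δ p) + (D - δ q)) - ((D - δ p) - (D - δ q)) ^ 2)
              - (2 * w * D - w * (D - δ p) - (D - δ p) ^ 2) * (2 * w * D - w * (D - δ q) - (D - δ q) ^ 2)) / 4 := by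
        ring
      have : 0 ≤ (2 * w * D * (2 * w * D - w * ((D - δ p) + (D - δ q)) - ((D - δ p) - (D - δ q)) ^ 2)
              - (2 * w * D - w * (D - δ p) - (D - δ p) ^ 2) * (2 * w * D - w * (D - δ q) - (D - δ q) ^ 2)) / 4 := by
        apply div_nonneg _ (by norm_num); linarith
      linarith
    intro l hl l' hl'
    rw [hH, mem_filter, mem_range] at hl hl'
    rcases le_total (δ l) (δ l') with h | h
    · exact key l l' hl.1 hl'.1 hl.2 h
    · have h2 := key l' l hl'.1 hl.1 hl'.2 h
      have e1 : (δ l' - δ l) ^ 2 = (δ l - δ l') ^ 2 := by ring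
      rw [e1, add_comm (δ l') (δ l), mul_comm] at h2
      exact h2
  have hHsub : H ⊆ range T := by rw [hH]; exact Finset.filter_subset _ _
  have hnn : ∀ l ∈ range T, ∀ l' ∈ range T,
      0 ≤ (w * D * (-(((δ l - δ l') ^ 2 - w * (δ l + δ l')) / 2))) * (u l * u l') := by
    intro l hl l' hl'
    rw [mem_range] at hl hl'
    exact mul_nonneg (mul_nonneg hwD0.le (by linarith [hMlow l l' hl hl'])) (mul_nonneg (hu l hl) (hu l' hl'))
  have hcm2 : cm ^ 2 = ∑ l ∈ H, ∑ l' ∈ H, ((-(((δ l - D) ^ 2 - w * (δ l + D)) / 2)) * (-(((δ l' - D) ^ 2 - w * (δ l' + D)) / 2)))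
      * (u l * u l') := by
    rw [hcm, sq, Finset.sum_mul_sum]
    refine Finset.sum_congr rfl fun l _ => Finset.sum_congr rfl fun l' _ => by ring
  have hA' : w * D * (-A) = ∑ l ∈ range T, ∑ l' ∈ range T, (w * D * (-(((δ l - δ l') ^ 2 - w * (δ l + δ l')) / 2))) * (u l * u l') := by
    rw [hA, ← Finset.sum_neg_distrib, Finset.mul_sum]
    refine Finset.sum_congr rfl fun l _ => ?_
    rw [← Finset.sum_neg_distrib, Finset.mul_sum]
    refine Finset.sum_congr rfl fun l' _ => by ring
  have hstep1 : ∑ l ∈ H, ∑ l' ∈ H, ((-(((δ l - D) ^ 2 - w * (δ l + D)) / 2)) * (-(((δ l' - D) ^ 2 - w * (δ l' + D)) / 2)))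
      * (u l * u l')
      ≤ ∑ l ∈ H, ∑ l' ∈ H, (w * D * (-(((δ l - δ l') ^ 2 - w * (δ l + δ l')) / 2))) * (u l * u l') := by
    refine Finset.sum_le_sum fun l hl => Finset.sum_le_sum fun l' hl' => ?_
    have hl0 : l < T := by have := hHsub hl; rwa [mem_range] at this
    have hl'0 : l' < T := by have := hHsub hl'; rwa [mem_range] at this
    exact mul_le_mul_of_nonneg_right (hpair l hl l' hl') (mul_nonneg (hu l hl0) (hu l' hl'0))
  have hstep2 : ∑ l ∈ H, ∑ l' ∈ H, (w * D * (-(((δ l - δ l') ^ 2 - w * (δ l + δ l')) / 2))) * (u l * u l')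
      ≤ ∑ l ∈ range T, ∑ l' ∈ range T, (w * D * (-(((δ l - δ l') ^ 2 - w * (δ l + δ l')) / 2))) * (u l * u l') :=
    calc ∑ l ∈ H, ∑ l' ∈ H, (w * D * (-(((δ l - δ l') ^ 2 - w * (δ l + δ l')) / 2))) * (u l * u l')
        ≤ ∑ l ∈ H, ∑ l' ∈ range T, (w * D * (-(((δ l - δ l') ^ 2 - w * (δ l + δ l')) / 2))) * (u l * u l') :=
          Finset.sum_le_sum fun l hl => Finset.sum_le_sum_of_subset_of_nonneg hHsub (fun l' hl' _ => hnn l (hHsub hl) l' hl')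
      _ ≤ ∑ l ∈ range T, ∑ l' ∈ range T, (w * D * (-(((δ l - δ l') ^ 2 - w * (δ l + δ l')) / 2))) * (u l * u l') :=
          Finset.sum_le_sum_of_subset_of_nonneg hHsub (fun l hl _ => Finset.sum_nonneg fun l' hl' => hnn l hl l' hl')
  have hkey : cm ^ 2 ≤ w * D * (-A) := by
    rw [hcm2, hA']; exact hstep1.trans hstep2
  -- assemble: A − 2ct − wD t² ≤ A + cm²/(wD) − D(D−w) u₀ t ≤ −D(D−w) u₀ t < 0
  have hfin : cm ^ 2 / (w * D) ≤ -A := by rw [div_le_iff₀ hwD0]; linarith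
  linarith

end ProductPlusOne

end Summit.ValiantsHypothesis.ValiantsHypothesis.Theorems.LacunarySymmetroidMatrixDescartes
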